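import Literature.Probability.RandomPlanarGeometry.SLESixHullLocalityFact
import Literature.Probability.RandomPlanarGeometry.LoewnerThrStoppedClass
import Literature.Probability.RandomPlanarGeometry.LoewnerThrPieces
import Literature.Probability.RandomPlanarGeometry.SLEImageLocalisationPaths
import Literature.Probability.RandomPlanarGeometry.SLESixHullLocalityEvents
import Literature.Probability.RandomPlanarGeometry.SLETraceHittingMarkov
import Literature.Probability.RandomPlanarGeometry.SLETraceGeneralBM
import Literature.Probability.RandomPlanarGeometry.SLETraceApproximation
import Literature.Probability.RandomPlanarGeometry.RohdeSchrammCor35Proofs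
import Literature.Probability.RandomPlanarGeometry.LocalMartingaleProofs
import Mathlib.Probability.BrownianMotion.Basic
import HarnessLib

/-!
# Locality of chordal SLE₆ w.r.t. a bounded hull, NEIGHBOURHOOD form: assembly with a.s. hypotheses and a.s. read-back

Topic `Probability/RandomPlanarGeometry`; one theorem (crux `stmt-CriticalPhenomena-0698`, stub
`stub_isLocal`). The variant of `sle_six_hull_locality_nbhd_of_thr` (`SLESixHullLocalityNbhd.lean`)
with the pathwise horizon properties taken ALMOST SURELY, the integrability of the clock rate derived
(`Loewner.integrableOn_thrClockRate`), AND the identification of the image Brownian motion with the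
through-swallow driver required only for ALMOST EVERY sample (the form delivered by the a.s. DDS
packaging `exists_thr_image_brownian_of_hasMartingaleClock_ae` of a progressive modification). Otherwise: the
probabilistic assembly of `sle_six_hull_locality_nbhd`
(`SLESixHullLocalityFact.lean`; Lawler–Schramm–Werner (2001) Thm. 2.2, curve form; Lawler (2005)
Thm. 6.13) from the THROUGH-SWALLOW image chain, exactly parallel to
`sle_six_hull_locality_alive_of_imageBM` (`SLESixHullLocalityAlive.lean`) with the alive localising
times replaced by a through-swallow horizon:

* (THR) for every nonempty `*`-hull `A` and `δ > 0` a horizon `H N` (stopping times, finite) up to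
  which the remaining hull `A ∖ K̂_t` is closed with finitely many values and an integrable clock rate,
  before which the trace avoids `A`, which a.s. eventually exceeds the first hit of any closed set
  containing the `δ`-neighbourhood of `A` hit before `A`, and at which the through-swallow image
  driving function in capacity time is `√6 ×` a Brownian motion (`thrImageDriverC`, `thrClock` of
  `LoewnerRemainingHull.lean`; the stochastic gluing + Dambis–Dubins–Schwarz);
* (TIP) the deterministic through-swallow tip identity `γ̂ (σ u) = E_A (γ u)` (stub
  `stub_thrTipIdentity`).

Proof: verbatim the alive assembly — functional `G η = [traceOf η]` stopped at its first hit of `S`,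
identification `Z = G(Û)` on `{τ_{S'} < H N}` through `Loewner.thr_stoppedPathClass_starMap_eq_stopClass`
and `Loewner.thr_firstHit_imageTrace_eq` (`LoewnerThrStoppedClass.lean`), error `≤ P{τ_{S'} ≥ H N} → 0`.
-/

noncomputable section

open Set Filter Topology Function Complex Metric MeasureTheory ProbabilityTheory
open UpperHalfPlane (upperHalfPlaneSet)
open scoped NNReal unitInterval ENNReal

namespace Literature.Probability.RandomPlanarGeometry

open Literature.Probability.Process Loewner
open scoped PathBorel

/-- **Locality of chordal SLE₆ with respect to a bounded hull, neighbourhood form, from the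
through-swallow image chain — almost-sure pathwise hypotheses and almost-sure read-back** (the form
delivered by the horizon construction and the a.s. packaging: closedness of the remaining hull up to and including the horizon and trace avoidance hold
almost surely; integrability of the clock rate is derived from closedness and finiteness,
`Loewner.integrableOn_thrClockRate`). [cite: LawlerSchrammWerner2001, Thm 2.2] -/
theorem sle_six_hull_locality_nbhd_of_thr_ae'
    (htip : ∀ {W : ℝ≥0 → ℝ} {A : Set ℂ}, Continuous W → W 0 = 0 → IsStarHull A → A.Nonempty →
      ∀ {β β₂ : ℝ≥0}, β₂ < β → (∀ t ≤ β, IsClosed (remHull W A t)) →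
      (remHull W A '' Set.Icc 0 β).Finite →
      ∀ {γ : ℝ≥0 → ℂ}, IsGeneratedByCurve W γ → (∀ t ≤ β, γ t ∉ A) →
      ∀ {U' : ℝ≥0 → ℝ}, Continuous U' → (∀ s, s ≤ thrClockC W A β₂ → U' s = thrImageDriverC W A β s) →
      ∀ {γ' : ℝ≥0 → ℂ}, IsGeneratedByCurve U' γ' → ∀ t ≤ β₂, γ' (thrClockC W A t) = starMap A (γ t))
    (hThr : ∀ {A : Set ℂ} (hA : IsStarHull A) (hne : A.Nonempty) {δ : ℝ}, 0 < δ →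
      ∃ H : ℕ → (ℝ≥0 → ℝ) → WithTop ℝ≥0,
        (∀ N, IsStoppingTime brownianFiltration (H N)) ∧ (∀ N ω, H N ω ≠ ⊤) ∧
        (∀ᵐ ω ∂preWienerMeasure, ∀ (N : ℕ) (T₀ : ℝ≥0), H N ω = T₀ →
          (∀ t ≤ T₀, IsClosed (remHull (drvK 6 (brownianCPath ω)) A t)) ∧
          (remHull (drvK 6 (brownianCPath ω)) A '' Set.Icc 0 T₀).Finite) ∧
        (∀ᵐ ω ∂preWienerMeasure, ∀ (N : ℕ) (t : ℝ≥0), (t : WithTop ℝ≥0) ≤ H N ω → sleTrace 6 ω t ∉ A) ∧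
        (∀ᵐ ω ∂preWienerMeasure, ∀ S₁ : Set ℂ, (∀ z : ℂ, 0 ≤ z.im → infDist z A ≤ δ → z ∈ S₁) →
          firstHit (sleTrace 6 ω) S₁ < firstHit (sleTrace 6 ω) A →
          ∃ t : ℝ≥0, firstHit (sleTrace 6 ω) S₁ = t ∧ ∀ᶠ N in atTop, (t : WithTop ℝ≥0) < H N ω) ∧
        (∀ N, ∃ Bc : ℝ≥0 → (ℝ≥0 → ℝ) × (ℝ≥0 → ℝ) → ℝ,
          IsBrownianReal Bc (preWienerMeasure.prod preWienerMeasure) ∧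
          (∀ s, Measurable (Bc s)) ∧ (∀ z, Continuous (Bc · z)) ∧
          ∀ᵐ z ∂(preWienerMeasure.prod preWienerMeasure), ∀ T₀ : ℝ≥0, H N z.1 = T₀ → 0 < T₀ →
            ∀ s : ℝ≥0, (s : ℝ) ≤ thrClock (drvK 6 (brownianCPath z.1)) A T₀ →
              Real.sqrt 6 * Bc s z = thrImageDriverC (drvK 6 (brownianCPath z.1)) A T₀ s)) :
    sle_six_hull_locality_nbhd := by
  intro A hA hne S S' hS hS' hdict hnb hltA T hT
  obtain ⟨δ, hδ, hnbhd⟩ := hnb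
  obtain ⟨H, hHst, hHtop, hHpath, hHavoid, hHex, hHBM⟩ := hThr hA hne hδ
  haveI := isProbabilityMeasure_preWienerMeasure'
  set P : Measure (ℝ≥0 → ℝ) := preWienerMeasure with hPdef
  set μ2 : Measure ((ℝ≥0 → ℝ) × (ℝ≥0 → ℝ)) := P.prod P with hμ2
  have hfst : Measure.QuasiMeasurePreserving Prod.fst μ2 P := Measure.quasiMeasurePreserving_fst
  have h60 : (6 : ℝ≥0) ≠ 0 := by norm_num
  have h68 : (6 : ℝ≥0) ≠ 8 := by norm_num
  have hgen : ∀ᵐ ω ∂P, ∃ γ, IsGeneratedByCurve (sleDriving 6 ω) γ := hasSLETrace_of_ne_eight_apply h68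
  have hWeq : ∀ ω, drvK 6 (brownianCPath ω) = sleDriving 6 ω := drvK_brownianCPath 6
  -- the random classes of the statement
  set Z : (ℝ≥0 → ℝ) → CurveClass ℂ := fun ω ↦ stoppedPathClass (starMap A) (sleTrace 6 ω)
    ((firstHit (sleTrace 6 ω) S').untopD 0) with hZ
  set Z' : (ℝ≥0 → ℝ) → CurveClass ℂ := fun ω ↦ stoppedPathClass id (sleTrace 6 ω)
    ((firstHit (sleTrace 6 ω) S).untopD 0) with hZ'
  change P {ω | Z ω ∈ T} = P {ω | Z' ω ∈ T}
  -- the path functional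
  set G : C(ℝ≥0, ℝ) → CurveClass ℂ := fun η ↦ stopClass (traceOf η) ((firstHit (traceOf η) S).untopD 0)
    with hGdef
  have hGm : Measurable G := measurable_stopClass_traceOf_firstHit hS
  have hGT : MeasurableSet {η | G η ∈ T} := hGm hT
  -- (a) the plain side: `Z' = G ∘ drivingPath` a.e.
  have hZ'G : ∀ᵐ ω ∂P, Z' ω = G (drivingPath 6 ω) := by
    filter_upwards [hgen] with ω hgω
    have htr : ⇑(traceOf (drivingPath 6 ω)) = sleTrace 6 ω := coe_traceOf_drivingPath hgω
    show stoppedPathClass id (sleTrace 6 ω) ((firstHit (sleTrace 6 ω) S).untopD 0) =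
      stopClass (traceOf (drivingPath 6 ω)) ((firstHit (traceOf (drivingPath 6 ω)) S).untopD 0)
    rw [stoppedPathClass_eq_stopClass (traceOf (drivingPath 6 ω)) (fun t ↦ by rw [htr]; rfl), htr]
  have hR : P {ω | Z' ω ∈ T} = P {ω | G (drivingPath 6 ω) ∈ T} := by
    refine measure_congr ?_
    filter_upwards [hZ'G] with ω hω
    show (Z' ω ∈ T) = (G (drivingPath 6 ω) ∈ T)
    rw [hω]
  -- a measurable version of the `S'`-hitting time and the exhaustion events
  obtain ⟨τS, hσst, hσeq⟩ := exists_isStoppingTime_rightCont_ae_eq_hitting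
    (hasSLETrace_of_ne_eight_apply h68) hS'
  have hσ' : ∀ᵐ ω ∂P, τS ω = firstHit (sleTrace 6 ω) S' := by
    filter_upwards [hσeq] with ω hω
    rw [hω, ← firstHit_eq_hittingAfter (fun t ω ↦ sleTrace 6 ω t) S' ω]
  set E : ℕ → Set ((ℝ≥0 → ℝ) × (ℝ≥0 → ℝ)) := fun m ↦ {z | τS z.1 < H m z.1} with hE
  have hEmeas : ∀ m, MeasurableSet (E m) := fun m ↦
    (measurableSet_setOf_lt_of_isStoppingTime hσst (hHst m)).preimage measurable_fst
  have hev : ∀ᵐ z ∂μ2, ∀ᶠ m in atTop, z ∈ E m := by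
    have h1 : ∀ᵐ ω ∂P, ∀ᶠ m in atTop, τS ω < H m ω := by
      filter_upwards [hltA, hσ', hHex] with ω hlt hσω hex
      obtain ⟨t, ht, hev⟩ := hex S' hnbhd hlt
      rw [hσω, ht]
      exact hev
    exact hfst.ae h1
  have htend : Tendsto (fun m ↦ μ2 (E m)ᶜ) atTop (𝓝 0) :=
    tendsto_measure_compl_of_ae_eventually_mem hEmeas hev
  -- (b) + (c): the two-sided bound at every level
  have hL : μ2 {z | Z z.1 ∈ T} = P {ω | Z ω ∈ T} := measure_prod_preimage_fst P P {ω | Z ω ∈ T}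
  have hbound : ∀ m, P {ω | Z ω ∈ T} ≤ P {ω | Z' ω ∈ T} + μ2 (E m)ᶜ ∧
      P {ω | Z' ω ∈ T} ≤ P {ω | Z ω ∈ T} + μ2 (E m)ᶜ := by
    intro m
    obtain ⟨Bc, hBcBM, hBcm, hBcc, hagree⟩ := hHBM m
    set U : (ℝ≥0 → ℝ) × (ℝ≥0 → ℝ) → ℝ≥0 → ℝ := fun z s ↦ Real.sqrt 6 * Bc s z with hUdef
    set Upath : (ℝ≥0 → ℝ) × (ℝ≥0 → ℝ) → C(ℝ≥0, ℝ) := fun z ↦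
      (⟨fun t ↦ Real.sqrt 6 * Bc t z, continuous_const.mul (hBcc z)⟩ : C(ℝ≥0, ℝ)) with hUpath
    have hUm : Measurable Upath :=
      Process.measurable_continuousMap_of_eval fun t ↦ (hBcm t).const_mul _
    have hlawU : μ2.map Upath = P.map (drivingPath 6) :=
      map_eq_map_drivingPath 6 exists_isBrownianReal_measurable_continuous_holds hBcBM hBcc hBcm
    have hgenU : ∀ᵐ z ∂μ2, ∃ γ', IsGeneratedByCurve (U z) γ' :=
      ae_isGeneratedByCurve_of_isBrownianReal hBcBM hBcc h60 h68
    -- identification on `E m`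
    have hB : ∀ᵐ z ∂μ2, z ∈ E m → Z z.1 = G (Upath z) := by
      filter_upwards [hgenU, hfst.ae hgen, hfst.ae hσ', hfst.ae hltA, hfst.ae hHex, hfst.ae hHavoid,
        hfst.ae hHpath, hagree] with z hγ' hgω hσω hlt hex havoid hpath hagz hzE
      obtain ⟨γ', hγ'⟩ := hγ'
      set ω := z.1 with hωdef
      obtain ⟨t, ht, -⟩ := hex S' hnbhd hlt
      -- the horizon `T₀ > t`
      obtain ⟨T₀, hT₀⟩ := WithTop.ne_top_iff_exists.1 (hHtop m ω)
      have hzE' : τS ω < H m ω := hzE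
      rw [hσω, ht, ← hT₀] at hzE'
      have htT : t < T₀ := WithTop.coe_lt_coe.1 hzE'
      have hT0pos : 0 < T₀ := lt_of_le_of_lt bot_le htT
      obtain ⟨hclosed, hfin⟩ := hpath m T₀ hT₀.symm
      have hWc : Continuous (sleDriving 6 ω) := continuous_sleDriving 6 ω
      have hW0 : sleDriving 6 ω 0 = 0 := sleDriving_zero 6 ω
      have hγgen : IsGeneratedByCurve (sleDriving 6 ω) (sleTrace 6 ω) := isGeneratedByCurve_trace hgω
      rw [hWeq] at hclosed hfin
      have hint : IntegrableOn (thrClockRate (sleDriving 6 ω) A) (Icc (0 : ℝ) T₀) :=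
        integrableOn_thrClockRate hWc hA hclosed hfin
      have hnotA : ∀ u, u ≤ T₀ → sleTrace 6 ω u ∉ A := fun u hu ↦
        havoid m u (by rw [← hT₀]; exact WithTop.coe_le_coe.2 hu)
      -- agreement of `U z` with the through-swallow image driver up to `σ t ≤ σ T₀`
      have hag : ∀ s, s ≤ thrClockC (sleDriving 6 ω) A t →
          U z s = thrImageDriverC (sleDriving 6 ω) A T₀ s := by
        intro s hs
        have hs' : (s : ℝ) ≤ thrClock (drvK 6 (brownianCPath z.1)) A T₀ := by
          rw [← hωdef, hWeq]
          calc (s : ℝ) ≤ thrClockC (sleDriving 6 ω) A t := NNReal.coe_le_coe.2 hs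
            _ = thrClock (sleDriving 6 ω) A t := coe_thrClockC hint htT.le
            _ ≤ thrClock (sleDriving 6 ω) A T₀ :=
                (strictMonoOn_thrClock hint).monotoneOn
                  ⟨t.coe_nonneg, NNReal.coe_le_coe.2 htT.le⟩ ⟨T₀.coe_nonneg, le_rfl⟩ (NNReal.coe_le_coe.2 htT.le)
        have h1 := hagz T₀ hT₀.symm hT0pos s hs'
        rw [hWeq] at h1
        exact h1
      have hU'c : Continuous (U z) := continuous_const.mul (hBcc z)
      have hγ'U : IsGeneratedByCurve (⇑(Upath z)) γ' := hγ'
      have htr : ⇑(traceOf (Upath z)) = γ' := coe_traceOf_eq hγ'U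
      -- the through-swallow tip identity up to `t`, class identity and hitting dictionary
      have htip' : ∀ u, u ≤ t → γ' (thrClockC (sleDriving 6 ω) A u) = starMap A (sleTrace 6 ω u) :=
        htip hWc hW0 hA hne htT hclosed hfin hγgen hnotA hU'c hag hγ'
      have hcls := thr_stoppedPathClass_starMap_eq_stopClass hA htT.le hint hγgen hnotA htip'
        (traceOf (Upath z)) (fun s ↦ by rw [htr]) le_rfl
      have hfh := thr_firstHit_imageTrace_eq htT.le hint hγgen hnotA htip' hγ'.continuous hS hS' hdict
        ht le_rfl
      show stoppedPathClass (starMap A) (sleTrace 6 ω) ((firstHit (sleTrace 6 ω) S').untopD 0) =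
        stopClass (traceOf (Upath z)) ((firstHit (traceOf (Upath z)) S).untopD 0)
      rw [htr, hfh, WithTop.untopD_coe, ht, WithTop.untopD_coe]
      exact hcls
    -- the law of `G (Û)`
    have hlaw : μ2 {z | G (Upath z) ∈ T} = P {ω | Z' ω ∈ T} := by
      calc μ2 {z | G (Upath z) ∈ T} = μ2.map Upath {η | G η ∈ T} := (Measure.map_apply hUm hGT).symm
        _ = P.map (drivingPath 6) {η | G η ∈ T} := by rw [hlawU]
        _ = P {ω | G (drivingPath 6 ω) ∈ T} := Measure.map_apply (measurable_drivingPath 6) hGT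
        _ = P {ω | Z' ω ∈ T} := hR.symm
    constructor
    · calc P {ω | Z ω ∈ T} = μ2 {z | Z z.1 ∈ T} := hL.symm
        _ ≤ μ2 ({z | G (Upath z) ∈ T} ∪ (E m)ᶜ) := by
            refine measure_mono_ae ?_
            filter_upwards [hB] with z hz
            intro hzT
            by_cases hzE : z ∈ E m
            · left
              show G (Upath z) ∈ T
              rw [← hz hzE]; exact hzT
            · right; exact hzE
        _ ≤ μ2 {z | G (Upath z) ∈ T} + μ2 (E m)ᶜ := measure_union_le _ _
        _ = P {ω | Z' ω ∈ T} + μ2 (E m)ᶜ := by rw [hlaw]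
    · calc P {ω | Z' ω ∈ T} = μ2 {z | G (Upath z) ∈ T} := hlaw.symm
        _ ≤ μ2 ({z | Z z.1 ∈ T} ∪ (E m)ᶜ) := by
            refine measure_mono_ae ?_
            filter_upwards [hB] with z hz
            intro hzT
            by_cases hzE : z ∈ E m
            · left
              show Z z.1 ∈ T
              rw [hz hzE]; exact hzT
            · right; exact hzE
        _ ≤ μ2 {z | Z z.1 ∈ T} + μ2 (E m)ᶜ := measure_union_le _ _
        _ = P {ω | Z ω ∈ T} + μ2 (E m)ᶜ := by rw [hL]
  -- let `m → ∞`
  have hlimZ' : Tendsto (fun m ↦ P {ω | Z' ω ∈ T} + μ2 (E m)ᶜ) atTop (𝓝 (P {ω | Z' ω ∈ T})) := by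
    have := (tendsto_const_nhds (x := P {ω | Z' ω ∈ T})).add htend
    rwa [add_zero] at this
  have hlimZ : Tendsto (fun m ↦ P {ω | Z ω ∈ T} + μ2 (E m)ᶜ) atTop (𝓝 (P {ω | Z ω ∈ T})) := by
    have := (tendsto_const_nhds (x := P {ω | Z ω ∈ T})).add htend
    rwa [add_zero] at this
  exact le_antisymm (ge_of_tendsto' hlimZ' fun m ↦ (hbound m).1)
    (ge_of_tendsto' hlimZ fun m ↦ (hbound m).2)

end Literature.Probability.RandomPlanarGeometry

end
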